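/-
Copyright (c) 2026 the pub-hodgecm-mathlib formalisation cell (harness21).  Prover seat hodgecm-mathlib-K2E3-p34 (g2), Track B «K2-LIT», engine E3, unit U4 «Keys»; PART
«U4Keys» socket :182 (U4f-χ₁-ram-one-pos), programme A_pos^{=} (memo `K2/K2E3-p37/g0/CENSUS-U4f-PosDepth.K2E3-p37-g0.md` §6 (A), §10 (c)), brick (c1) «THE BIG CELL AT LEVEL `J_n`
ON `U(Φ₃)(L⁺_v)`» (CM dress of ★ p861613); dealer K2E3-plan (g5), K2 bus 2026-09-04T16:44Z.  KERNEL module: THEOREMS ONLY (no definition, no named fact, no `sorry`, no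
instance, no notation).
-/
import Summits.HodgeConjecture.HodgeConjecture.Theorems.K2E3BranchALettersCM                -- ★ Z2A-3c (i) (K2E3-p06 g4): the (G3) frame + `(t ht) (w₀ hw₀)`, `symm_mem_P_of_mem_borelU`, `symm_mem_of_mem_inf`, the template `dichotomy_conj`; brings ★ Z2A-3b `coe_eA_apply`, `map_weyl_eq_weylLongU`, `map_mem_unipotentU_of_mem`
import Summits.HodgeConjecture.HodgeConjecture.Theorems.K2E3LowerUnipotentBigCellIntegral     -- ★ p861613 (K2E3-p37 g0): MODEL big cell `exists_borel_mul_weylLongU_mul_mem_inf_pow` (`|ū₂₀| ≥ 1 ⟹ ū ∈ P·w·J_n`); brings ★ Z2A-3a `exists_coe_eq_lower_of_mem_map`, ★ p861548 `J_n`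
import Summits.HodgeConjecture.HodgeConjecture.Theorems.K2E3LevelNDepthWitnessCM             -- ★ §10 (b) (R90-C10-p02 g2): `symm_mem_of_mem_model` (`eA⁻¹` of the model `J_n` lies in `Jn`) — cited, not restated
import HarnessLib

/-!
# K2 ∕ E3 «EllipticInputs», unit U4 «Keys» — socket :182 (positive depth), programme A_pos, brick (c1): THE BIG CELL AT LEVEL `J_n`, CM DRESS
# «`|z| ≥ 1 ⟹ w₀ n w₀ = h · w₀ · b′` with `h ∈ P`, `b′ ∈ J_n`» on `U(Φ₃)(L⁺_v)`, `v` non-split, where `ū(x, z) = eA(w₀ n w₀)`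
# [Casselman1995 Prop. 1.3.1; BruhatTits1972 (4.4.4); Roche1998 §3–§4; Rogawski1990 §1.10]

Cell hodgecm-mathlib, Track B «K2-LIT», engine E3, crux item H413 = `stmt-HodgeConjecture-24833` (route `HCCMUnconditional`); line `K2_E3_EllipticInputs`, PART «U4Keys»
socket :182 `sig_K2E3KeysThmTwoContractingRamifiedCharOnePosDepth` (Branch A at POSITIVE depth, programme A_pos^{=} of K2E3-p37 (g0)'s memo §6–§10).
`--supports stmt-HodgeConjecture-24833 --as helper`; THEOREMS ONLY; NOT THE PAYER (one input of the (c3) assembly `not_reducible_of_posDepth_of_normChar_ne_one_eq`).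

THE POINT.  The cell-family engine ★ `K2E3BranchAContradictionCells.false_of_typeVector_of_integral_eq_zero_of_cells` (p861573) runs at level `B := J_n` with the family
`R := {w₀} ∪ {intermediate representatives}`; its covering letter `hcells` asks, for every `n ∈ N`, either `w₀ n w₀ ∈ J_n` or `w₀ n w₀ = h · r · b′` (`h ∈ P`, `r ∈ R`,
`b′ ∈ J_n`).  On the BIG CELL — `|z| ≥ 1` for `ū(x, z) := eA(w₀ n w₀) ∈ N̄_w` — the representative is `r = w₀`: ★ p861613 (MODEL, one-place `U(σ_w, Φ₃)(L_w)`) gives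
`ū = p · w · u` with `p ∈ B_w` and `u ∈ N_w ∩ K₀ ≤ J_n` for EVERY `n`.  This file is the CM DRESS of that statement along the (G3) equivalence `eA` (letters `hK0 hJn`, `w₀`
with `eA w₀ = w` ★ `map_weyl_eq_weylLongU`), i.e. the `J_n`-twin of the second disjunct of ★ `K2E3BranchALettersCM.dichotomy_conj` (whose first disjunct «`∈ I`» has NO `J_n`
analogue off the big cell — that is where the depth witnesses (★ p861978∕p862033, ★ p862085 cover, (b) CM dress) come in):
* (`eA⁻¹` of an element of the model `J_n = K₀ ⊓ g_nK₀g_n⁻¹` lies in `Jn`: ★ `K2E3LevelNDepthWitnessCM.symm_mem_of_mem_model`, cited;)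
* §1 `map_weylConj_mem_map` (`eA(w₀ n w₀) ∈ N_w.map (conj w)`) and **`exists_coe_map_weylConj_eq_lower`** — the coordinates: `eA(w₀ n w₀) = !![1, 0, 0; -σ x, 1, 0; z, x, 1]`
  with `z + σz + xσx = 0` (★ `exists_coe_eq_lower_of_mem_map` read through `eA`) — the `(x, z)` by which (c3) splits `N` into big cell ∕ `J_n` ∕ intermediate cells (§1);
* §2 **`exists_eq_borel_mul_weyl_mul_levelN_of_one_le_v`** — `1 ≤ |(eA(w₀ n w₀))₂₀|` ⟹ `∃ h ∈ t.P, ∃ b′ ∈ Jn, w₀ n w₀ = h * w₀ * b′` (the engine's `hcells` disjunct at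
  `r := w₀`), and its coordinate form `…_of_coe_eq` (hypothesis `1 ≤ Valued.v z` on the §1 coordinates).
HONEST LABEL: HC_CM is proved only modulo the 7 printed citations (2 remaining named inputs: hLiu418 = stmt-HodgeConjecture-24832, h413 = stmt-HodgeConjecture-24833) until
rung 0 closes; count-neutral — this file does NOT pay the leaf; :182 stays OPEN.

## References
* [Casselman1995] W. Casselman, *Introduction to the theory of admissible representations of p-adic reductive groups* (1995), Prop. 1.3.1 (Bruhat decomposition), Prop. 1.4.4.
* [BruhatTits1972] F. Bruhat, J. Tits, Publ. Math. IHÉS 41 (1972), (4.4.3)–(4.4.4).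
* [Roche1998] A. Roche, Ann. Sci. ÉNS (4) 31 (1998), §3–§4 (the groups `J_χ` and the support of `(J, θ)`-spherical vectors).
* [Rogawski1990] J. D. Rogawski, *Automorphic Representations of Unitary Groups in Three Variables*, Ann. of Math. Stud. 123 (1990), §1.10 p. 9.
* [PlatonovRapinchuk1994] V. Platonov, A. Rapinchuk, *Algebraic Groups and Number Theory* (1994), §5.1 (the one-place model at a non-split place).
-/

set_option autoImplicit false
-- the mandated namespace has the single-problem summit's repeated segment (`HodgeConjecture.HodgeConjecture`)
set_option linter.dupNamespace false

noncomputable section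

open NumberField IsDedekindDomain
open scoped Matrix MatrixGroups WithZero Valued
open Literature.NumberTheory Literature.NumberTheory.Automorphic Literature.NumberTheory.Automorphic.UnitaryGroup
open Literature.NumberTheory.Rogawski1990

namespace Summit.HodgeConjecture.HodgeConjecture.Cruxes.H413.K2E3LowerUnipotentBigCellCM

open Summit.HodgeConjecture.HodgeConjecture.Cruxes.H413
open Summit.HodgeConjecture.HodgeConjecture.Cruxes.H413.K2E3DepthZeroIwahoriCharacterCM
open Summit.HodgeConjecture.HodgeConjecture.Cruxes.H413.K2E3BranchALettersCM

variable (L : Type) [Field L] [NumberField L] [IsCMField L] (v : HeightOneSpectrum (𝓞 ↥(maximalRealSubfield L)))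
  (w : PlacesOver L v) (hw : IsCMField.complexConj L • w.1 = w.1)
  (eA : Gqs L v ≃ₜ* ↥(unitaryGroupOfForm (galAdicCompletionMap (L := L) (IsCMField.complexConj L) hw) ((StdForm.antidiagonal 3).over (w.1.adicCompletion L))))
  (heA : ∀ g : Gqs L v,
    ((eA g : ↥(unitaryGroupOfForm (galAdicCompletionMap (L := L) (IsCMField.complexConj L) hw) ((StdForm.antidiagonal 3).over (w.1.adicCompletion L)))) :
        GL (Fin 3) (w.1.adicCompletion L)) =
      ((localNonsplitEquiv (IsCMField.complexConj L) (qsForm L) (IsCMField.complexConj_ne_one L) w hw g :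
        ↥(unitaryGroupOfForm (galAdicCompletionMap (L := L) (IsCMField.complexConj L) hw) (placeForm (qsForm L) w.1))) : GL (Fin 3) (w.1.adicCompletion L)))
  {ϖ : w.1.adicCompletion L} (hϖ : Valued.v ϖ = WithZero.exp (-1 : ℤ))
  (g₁ : GL (Fin 3) (w.1.adicCompletion L)) (hg₁ : (g₁ : Matrix (Fin 3) (Fin 3) (w.1.adicCompletion L)) = Matrix.diagonal ![(1 : w.1.adicCompletion L), 1, ϖ])
  (K0 K1 I : Subgroup (Gqs L v))
  (hK0 : K0 = ((glInt 3 (w.1.adicCompletion L)).subgroupOf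
    (unitaryGroupOfForm (galAdicCompletionMap (L := L) (IsCMField.complexConj L) hw) ((StdForm.antidiagonal 3).over (w.1.adicCompletion L)))).comap
      eA.toMulEquiv.toMonoidHom)
  (hK1 : K1 = (((glInt 3 (w.1.adicCompletion L)).map (MulAut.conj g₁).toMonoidHom).subgroupOf
    (unitaryGroupOfForm (galAdicCompletionMap (L := L) (IsCMField.complexConj L) hw) ((StdForm.antidiagonal 3).over (w.1.adicCompletion L)))).comap
      eA.toMulEquiv.toMonoidHom)
  (hI : I = K0 ⊓ K1)
  {n : ℕ} (gn : GL (Fin 3) (w.1.adicCompletion L))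
  (hgn : (gn : Matrix (Fin 3) (Fin 3) (w.1.adicCompletion L)) = Matrix.diagonal ![(1 : w.1.adicCompletion L), 1, ϖ ^ n])
  (Jn : Subgroup (Gqs L v))
  (hJn : Jn = K0 ⊓ (((glInt 3 (w.1.adicCompletion L)).map (MulAut.conj gn).toMonoidHom).subgroupOf
    (unitaryGroupOfForm (galAdicCompletionMap (L := L) (IsCMField.complexConj L) hw) ((StdForm.antidiagonal 3).over (w.1.adicCompletion L)))).comap
      eA.toMulEquiv.toMonoidHom)
  (t : ParabolicTriple (Gqs L v)) (ht : t = cmBorelTriple L 3 v)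
  (w₀ : Gqs L v) (hw₀ : Units.val (w₀.val : GL (Fin 3) (LocalRing L v)) = cmLocalForm L 3 v)

/-! ## §1 The coordinates `(x, z)` of `eA(w₀ n w₀) = ū(x, z) ∈ N̄_w` -/

include heA ht hw₀ in
/-- **`eA(w₀ n w₀) ∈ N̄_w = N_w.map (conj w)`** for `n ∈ N` (★ `map_mem_unipotentU_of_mem`, `eA w₀ = w` ★ `map_weyl_eq_weylLongU`, `w⁻¹ = w`); the first step of ★
`dichotomy_conj`, exposed. [cite: Rogawski1990, §1.10 p. 9] [cite: PlatonovRapinchuk1994, §5.1] -/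
theorem map_weylConj_mem_map {n : Gqs L v} (hn : n ∈ t.N) :
    eA (w₀ * n * w₀) ∈
      ((borelTriple (galAdicCompletionMap (L := L) (IsCMField.complexConj L) hw) ((StdForm.antidiagonal 3).over (w.1.adicCompletion L)) rfl).N).map
        (MulAut.conj (weylLongU (galAdicCompletionMap (L := L) (IsCMField.complexConj L) hw)
          (rfl : (StdForm.antidiagonal 3).over (w.1.adicCompletion L) = _))).toMonoidHom := by
  have hwL := map_weyl_eq_weylLongU L v w hw eA heA w₀ hw₀
  have hwLinv : (weylLongU (galAdicCompletionMap (L := L) (IsCMField.complexConj L) hw) (rfl : (StdForm.antidiagonal 3).over (w.1.adicCompletion L) = _))⁻¹ =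
      weylLongU (galAdicCompletionMap (L := L) (IsCMField.complexConj L) hw) rfl :=
    inv_eq_of_mul_eq_one_right (weylLongU_mul_weylLongU _ _)
  refine Subgroup.mem_map.2 ⟨eA n, map_mem_unipotentU_of_mem L v w hw eA heA t ht hn, ?_⟩
  rw [MulEquiv.coe_toMonoidHom, MulAut.conj_apply, map_mul, map_mul, hwL, hwLinv]

include hw heA ht hw₀ in
/-- **THE COORDINATES `(x, z)` OF `w₀ n w₀`**: for `n ∈ N`, `eA(w₀ n w₀) = ū(x, z) = !![1, 0, 0; -σ x, 1, 0; z, x, 1]` with `z + σz + xσx = 0` (★ `exists_coe_eq_lower_of_mem_map`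
through `eA`).  `|z| ≥ 1` is the BIG CELL (§2), `|x|, |z| ≤ |ϖ|ⁿ` is `J_n`, the rest are the intermediate cells of the level-`n` family. [cite: Rogawski1990, §1.10 p. 9]
[cite: Casselman1995, Prop. 1.3.1] -/
theorem exists_coe_map_weylConj_eq_lower {n : Gqs L v} (hn : n ∈ t.N) :
    ∃ x z : w.1.adicCompletion L,
      ((((eA (w₀ * n * w₀) : ↥(unitaryGroupOfForm (galAdicCompletionMap (L := L) (IsCMField.complexConj L) hw) ((StdForm.antidiagonal 3).over (w.1.adicCompletion L)))) :
          GL (Fin 3) (w.1.adicCompletion L)) : Matrix (Fin 3) (Fin 3) (w.1.adicCompletion L)) =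
        !![1, 0, 0; -(galAdicCompletionMap (L := L) (IsCMField.complexConj L) hw) x, 1, 0; z, x, 1]) ∧
      z + (galAdicCompletionMap (L := L) (IsCMField.complexConj L) hw) z + x * (galAdicCompletionMap (L := L) (IsCMField.complexConj L) hw) x = 0 := by
  have hσσ : ∀ x, (galAdicCompletionMap (L := L) (IsCMField.complexConj L) hw) ((galAdicCompletionMap (L := L) (IsCMField.complexConj L) hw) x) = x :=
    galAdicCompletionMap_galAdicCompletionMap_of_smul_eq (IsCMField.complexConj L) w (IsCMField.complexConj_ne_one L) hw
  exact K2E3LowerUnipotentBorelIwahori.exists_coe_eq_lower_of_mem_map (galAdicCompletionMap (L := L) (IsCMField.complexConj L) hw)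
    (rfl : (StdForm.antidiagonal 3).over (w.1.adicCompletion L) = _) hσσ (map_weylConj_mem_map L v w hw eA heA t ht w₀ hw₀ hn)

/-! ## §2 The big cell `|z| ≥ 1`: `w₀ n w₀ ∈ P · w₀ · J_n` -/

include hw heA hϖ hK0 hgn hJn ht hw₀ in
set_option maxHeartbeats 1600000 in
-- the `Gqs L v` ∕ matrix-subgroup carriers are definitionally equal but unify slowly (class of ★ `dichotomy_conj`)
/-- **THE BIG CELL AT LEVEL `J_n` (CM): `|(eA(w₀ n w₀))₂₀| ≥ 1 ⟹ w₀ n w₀ = h · w₀ · b′` with `h ∈ P`, `b′ ∈ J_n`** — for every `n` (no `1 ≤ n`).  ★ p861613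
`exists_borel_mul_weylLongU_mul_mem_inf_pow` on the one-place model `U(σ_w, Φ₃)(L_w)` (`ū(x,z) = p · w · u(x∕z, 1∕z)`, `u ∈ N_w ∩ K₀ ≤ J_n`) pulled back along `eA`
(`eA⁻¹ p ∈ P` ★ `symm_mem_P_of_mem_borelU`, `eA⁻¹ u ∈ Jn` ★ `symm_mem_of_mem_model`, `eA w₀ = w`).  This is the `hcells` disjunct of ★ p861573 at the representative `r := w₀`; the witness
`hwit(w₀)` at level `J_n` is ★∕📤 `K2E3BranchATorusWitnessLevelN.exists_torusWitness_levelN`. [cite: Casselman1995, Prop. 1.3.1] [cite: BruhatTits1972, (4.4.4)]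
[cite: Roche1998, §3–§4] [cite: Rogawski1990, §1.10 p. 9] -/
theorem exists_eq_borel_mul_weyl_mul_levelN_of_one_le_v {n : Gqs L v} (hn : n ∈ t.N)
    (hz : 1 ≤ Valued.v ((((eA (w₀ * n * w₀) :
        ↥(unitaryGroupOfForm (galAdicCompletionMap (L := L) (IsCMField.complexConj L) hw) ((StdForm.antidiagonal 3).over (w.1.adicCompletion L)))) :
          GL (Fin 3) (w.1.adicCompletion L)) : Matrix (Fin 3) (Fin 3) (w.1.adicCompletion L)) 2 0)) :
    ∃ h ∈ t.P, ∃ b' ∈ Jn, w₀ * n * w₀ = h * w₀ * b' := by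
  have hσσ : ∀ x, (galAdicCompletionMap (L := L) (IsCMField.complexConj L) hw) ((galAdicCompletionMap (L := L) (IsCMField.complexConj L) hw) x) = x :=
    galAdicCompletionMap_galAdicCompletionMap_of_smul_eq (IsCMField.complexConj L) w (IsCMField.complexConj_ne_one L) hw
  have hvσ : ∀ x, Valued.v (galAdicCompletionMap (L := L) (IsCMField.complexConj L) hw x) = Valued.v x :=
    fun x => valued_galAdicCompletionMap (L := L) (IsCMField.complexConj L) hw x
  have hwL := map_weyl_eq_weylLongU L v w hw eA heA w₀ hw₀
  obtain ⟨p, hp, u, hu, e⟩ := K2E3LowerUnipotentBigCellIntegral.exists_borel_mul_weylLongU_mul_mem_inf_pow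
    (galAdicCompletionMap (L := L) (IsCMField.complexConj L) hw) (rfl : (StdForm.antidiagonal 3).over (w.1.adicCompletion L) = _) hσσ hvσ hϖ gn hgn
    (map_weylConj_mem_map L v w hw eA heA t ht w₀ hw₀ hn) hz
  refine ⟨eA.symm p, symm_mem_P_of_mem_borelU L v w hw eA heA t ht hp, eA.symm u,
    K2E3LevelNDepthWitnessCM.symm_mem_of_mem_model L v w hw eA K0 hK0 gn Jn hJn hu, ?_⟩
  apply eA.injective
  rw [e, map_mul, map_mul, ContinuousMulEquiv.apply_symm_apply, ContinuousMulEquiv.apply_symm_apply, hwL]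

include hw heA hϖ hK0 hgn hJn ht hw₀ in
set_option maxHeartbeats 1600000 in
-- as above
/-- **Coordinate form**: if `eA(w₀ n w₀) = !![1, 0, 0; -σ x, 1, 0; z, x, 1]` (§1) and `1 ≤ |z|`, then `w₀ n w₀ = h · w₀ · b′` with `h ∈ P`, `b′ ∈ J_n` — the shape in which the
(c3) assembly calls the big cell after splitting on `Valued.v z`. [cite: Casselman1995, Prop. 1.3.1] [cite: BruhatTits1972, (4.4.4)] [cite: Roche1998, §3–§4] -/
theorem exists_eq_borel_mul_weyl_mul_levelN_of_coe_eq {n : Gqs L v} (hn : n ∈ t.N) {x z : w.1.adicCompletion L}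
    (hxz : (((eA (w₀ * n * w₀) :
        ↥(unitaryGroupOfForm (galAdicCompletionMap (L := L) (IsCMField.complexConj L) hw) ((StdForm.antidiagonal 3).over (w.1.adicCompletion L)))) :
          GL (Fin 3) (w.1.adicCompletion L)) : Matrix (Fin 3) (Fin 3) (w.1.adicCompletion L)) =
        !![1, 0, 0; -(galAdicCompletionMap (L := L) (IsCMField.complexConj L) hw) x, 1, 0; z, x, 1])
    (hz : 1 ≤ Valued.v z) :
    ∃ h ∈ t.P, ∃ b' ∈ Jn, w₀ * n * w₀ = h * w₀ * b' := by
  refine exists_eq_borel_mul_weyl_mul_levelN_of_one_le_v L v w hw eA heA hϖ K0 hK0 gn hgn Jn hJn t ht w₀ hw₀ hn ?_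
  rw [hxz]
  simpa using hz

end Summit.HodgeConjecture.HodgeConjecture.Cruxes.H413.K2E3LowerUnipotentBigCellCM

end
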